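import Mathlib
import Summits.ValiantsHypothesis.ValiantsHypothesis.Theorems.LacunarySymmetroidMatrixDescartesStubDescartesCeiling
import Summits.ValiantsHypothesis.ValiantsHypothesis.Theorems.LacunarySymmetroidMatrixDescartesStubArith4

/-!
# `MatrixDescartes` (stmt-ValiantsHypothesis-18050) — the DEGREE CEILING and the mildly-lacunary sector:
# the crux has no content for exponents of quasi-polynomial height

HONEST FRAMING.  Cell `pub-symmetroid`, seat `val-sym-mdr-p2`; helper file `--supports` the crux
`Theses.LacunarySymmetroid.MatrixDescartes`.  Elementary bookkeeping that LOCATES the crux: together with the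
Descartes-trivial small sizes and the low-rank / few-fat-letters sectors it says where a counterexample must
live; it proves nothing about the crux there, nothing about `DoorA26` / `DoorA34`, nothing about `VP ≠ VNP`.

DEGREE CEILING (`card_roots_det_pencil_le_degree`).  For every `K`-term lacunary pencil of real `m × m`
matrices with exponents `dₗ ≤ D`, `det (∑ₗ X^{dₗ} Sₗ)` has degree `≤ m·D`
(`DegreeCeiling.natDegree_det_pencil_le`, from the count-vector description of the support, tree
`StubDescartesCeiling.support_det_pencil_subset`), hence at most `m·D` distinct real zeros.

MILDLY-LACUNARY SECTOR (`mildlyLacunary_mdr`).  Consequently, for all `c, q` there is `K₀` such that for all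
`K ≥ K₀`, all sizes `m ≤ 2^((⌊log₂K⌋+c)^c)` and all pencils whose exponents have the same quasi-polynomial
height `dₗ ≤ 2^((⌊log₂K⌋+c)^c)`, `Z^q ≤ 2^(K⌊log₂K⌋)` (`Z ≤ m·D ≤ 2^((⌊log₂K⌋+c+1)^(c+1))` is absorbed by
the regime, tree `stub_arith4`).  So the inequality of `MatrixDescartes` can only fail on pencils whose
exponent height is super-quasi-polynomial in `K` — genuinely lacunary pencils — in addition to the size window
`K^(1+o(1)) ≤ m` and the fat-letter count of the companion files.  Elementary; axioms `propext`,
`Classical.choice`, `Quot.sound`.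
-/

-- layout Summits/ValiantsHypothesis/ValiantsHypothesis forces the duplicated namespace component
set_option linter.dupNamespace false

namespace Summit.ValiantsHypothesis.ValiantsHypothesis.Theorems.LacunarySymmetroidMatrixDescartes

open Polynomial Finset
open scoped BigOperators Polynomial

namespace DegreeCeiling

/-- **Degree ceiling**: if all exponents are `≤ D`, the pencil determinant has degree `≤ m·D` (every
exponent in its support is `∑ₗ nₗ dₗ` for a count vector with `∑ nₗ = m`). [folklore] -/
theorem natDegree_det_pencil_le {K m : ℕ} (d : Fin K → ℕ) (S : Fin K → Matrix (Fin m) (Fin m) ℝ) (D : ℕ)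
    (hD : ∀ l, d l ≤ D) :
    (Matrix.det (∑ l, ((Polynomial.X : Polynomial ℝ) ^ d l) • (S l).map Polynomial.C)).natDegree
      ≤ m * D := by
  by_cases hP : Matrix.det (∑ l, ((Polynomial.X : Polynomial ℝ) ^ d l) • (S l).map Polynomial.C) = 0
  · rw [hP, Polynomial.natDegree_zero]
    exact Nat.zero_le _
  · have hmem := StubDescartesCeiling.support_det_pencil_subset d S
      (Polynomial.natDegree_mem_support_of_nonzero hP)
    obtain ⟨s, -, hs⟩ := Finset.mem_image.1 hmem
    rw [← hs]
    calc ((s : Multiset (Fin K)).map d).sum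
        ≤ Multiset.card ((s : Multiset (Fin K)).map d) • D :=
          Multiset.sum_le_card_nsmul _ _ fun x hx => by
            obtain ⟨l, -, rfl⟩ := Multiset.mem_map.1 hx
            exact hD l
      _ = m * D := by rw [Multiset.card_map, Sym.card_coe, smul_eq_mul]

end DegreeCeiling

/-- **Degree ceiling for real zeros**: a `K`-term lacunary pencil of real `m × m` matrices with exponents
`≤ D` has at most `m·D` distinct real zeros of its determinant (the zero polynomial has none). [folklore] -/
theorem card_roots_det_pencil_le_degree {K m : ℕ} (d : Fin K → ℕ) (S : Fin K → Matrix (Fin m) (Fin m) ℝ)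
    (D : ℕ) (hD : ∀ l, d l ≤ D) :
    (Matrix.det (∑ l, ((Polynomial.X : Polynomial ℝ) ^ d l) • (S l).map Polynomial.C)
      ).roots.toFinset.card ≤ m * D :=
  (Multiset.toFinset_card_le _).trans ((Polynomial.card_roots' _).trans
    (DegreeCeiling.natDegree_det_pencil_le d S D hD))

/-- Squaring a quasi-polynomial stays quasi-polynomial: `(2^((L+c)^c))² ≤ 2^((L+c+1)^(c+1))` for
`L ≥ 1`. [folklore] -/
theorem two_pow_sq_le (L c : ℕ) (hL : 1 ≤ L) :
    2 ^ ((L + c) ^ c) * 2 ^ ((L + c) ^ c) ≤ 2 ^ ((L + (c + 1)) ^ (c + 1)) := by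
  rw [← pow_add]
  refine Nat.pow_le_pow_right (by norm_num) ?_
  calc (L + c) ^ c + (L + c) ^ c = 2 * (L + c) ^ c := by ring
    _ ≤ (L + c + 1) * (L + c) ^ c := Nat.mul_le_mul_right _ (by omega)
    _ ≤ (L + c + 1) * (L + c + 1) ^ c :=
        Nat.mul_le_mul_left _ (Nat.pow_le_pow_left (Nat.le_succ _) c)
    _ = (L + (c + 1)) ^ (c + 1) := by rw [← add_assoc, pow_succ, mul_comm]

/-- **Mildly-lacunary sector.**  For all `c, q` there is `K₀` such that for all `K ≥ K₀`, all sizes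
`m ≤ 2^((⌊log₂K⌋+c)^c)`, all exponent vectors of height `dₗ ≤ 2^((⌊log₂K⌋+c)^c)` and all real `m × m`
matrices `Sₗ` (symmetric or not), the number `Z` of distinct real zeros of `det (∑ₗ X^{dₗ} Sₗ)` satisfies
`Z^q ≤ 2^(K⌊log₂K⌋)`: the inequality of `MatrixDescartes` is automatic unless the exponents are of
super-quasi-polynomial height in `K`.  Nothing is claimed for genuinely lacunary pencils. [folklore] -/
theorem mildlyLacunary_mdr (c q : ℕ) : ∃ K₀ : ℕ, ∀ K m : ℕ, K₀ ≤ K →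
    m ≤ 2 ^ ((Nat.log 2 K + c) ^ c) →
    ∀ (d : Fin K → ℕ) (S : Fin K → Matrix (Fin m) (Fin m) ℝ),
      (∀ l, d l ≤ 2 ^ ((Nat.log 2 K + c) ^ c)) →
      (Matrix.det (∑ l, ((Polynomial.X : Polynomial ℝ) ^ d l) • (S l).map Polynomial.C)
        ).roots.toFinset.card ^ q ≤ 2 ^ (K * Nat.log 2 K) := by
  obtain ⟨K₁, hK₁⟩ := stub_arith4 (c + 1) q
  refine ⟨max K₁ 2, fun K m hK hm d S hd => ?_⟩
  have hK₁K : K₁ ≤ K := le_trans (le_max_left _ _) hK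
  have hK2 : 2 ≤ K := le_trans (le_max_right _ _) hK
  have hlog : 1 ≤ Nat.log 2 K := by
    calc 1 = Nat.log 2 2 := by decide
      _ ≤ Nat.log 2 K := Nat.log_mono_right hK2
  have hZ := card_roots_det_pencil_le_degree d S _ hd
  refine hK₁ K _ hK₁K (hZ.trans ?_)
  exact (Nat.mul_le_mul hm le_rfl).trans (two_pow_sq_le (Nat.log 2 K) c hlog)

end Summit.ValiantsHypothesis.ValiantsHypothesis.Theorems.LacunarySymmetroidMatrixDescartes
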